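import Summits.CriticalPhenomena.PercolationContinuityZ3.Theorems.PercNearOneGluingNoHeavyLowerTailTwoPortPeelingLevelTwoTranslate
import Summits.CriticalPhenomena.PercolationContinuityZ3.Theorems.PercNearOneGluingNoHeavyLowerTailTwoPortPeelingRelayOrder
import HarnessLib

/-!
# `NoHeavyLowerTail` (stmt-CriticalPhenomena-4575) — two-port peeling: level-2 translation packages

Route `PercNearOneGluingNoHeavy`, seat `prim-gen-swap` (gen 5); memo TWO-PORT-PEELING.md §5 (P2), §6.  Level-2 translation packages: for a
configuration `ω` in which the two hubs `u, v` are isolated, membership of `ω` in each of the eighteen events of the comonotone certificate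
(loneliness / observer / CS₂-pair events pulled back along the glue maps of the four worlds) is equivalent to an elementary statement about
`ω` (attachments and small clusters).  These are the `iff` hypotheses of `comonotone_pointwise_abstract`.  No definitions, no named facts, no sorries.
-/

noncomputable section

namespace Summit.CriticalPhenomena.PercolationContinuityZ3.Theorems

open MeasureTheory Set Literature.Probability.LatticeModels Literature.Probability.Percolation
open scoped Classical BigOperators

variable {n : ℕ}

namespace TwoPortPeeling


/-- Level-2 membership translations, worlds `0` and `U` (glue at `u`). [this file] -/
theorem iffs_base_u (A : Finset (Fin n)) (ω : BondConfig (Fin n))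
    (u v a a' b b' c : Fin n) (j : ℕ) (hj : j ≤ 2) (hu : u ∉ A) (hv : v ∉ A) (huv : u ≠ v)
    (ha : a ∈ A) (ha' : a' ∈ A) (hb : b ∈ A) (hb' : b' ∈ A) (hc : c ∈ A)
    (haa' : a ≠ a') (hab : a ≠ b) (ha'b : a' ≠ b)
    (hca : c ≠ a) (hca' : c ≠ a')
    (hisoU : ∀ y : Fin n, y ≠ u → s(u, y) ∉ ω) (hisoV : ∀ y : Fin n, y ≠ v → s(v, y) ∉ ω) :
    (ω ∈ {ω : BondConfig (Fin n) | (A.filter fun z => ω ∈ openConn c z).card ≤ j} ↔ ((A.filter fun z => ω ∈ openConn c z).card ≤ j)) ∧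
    (ω ∈ {ω : BondConfig (Fin n) | (A.filter fun z => ω ∈ openConn a z).card ≤ j} ↔ ((A.filter fun z => ω ∈ openConn a z).card ≤ j)) ∧
    (ω ∈ {ω : BondConfig (Fin n) | (A.filter fun z => ω ∈ openConn b z).card ≤ j} ↔ ((A.filter fun z => ω ∈ openConn b z).card ≤ j)) ∧
    (ω ∈ {ω : BondConfig (Fin n) | 1 ≤ (A.filter fun z => ω ∈ openConn u z).card ∧ (A.filter fun z => ω ∈ openConn u z).card ≤ j} ↔ False) ∧
    (ω ∈ (fun ω : BondConfig (Fin n) => insert s(u, a) (insert s(u, a') ω)) ⁻¹' {ω : BondConfig (Fin n) | (A.filter fun z => ω ∈ openConn c z).card ≤ j} ↔ (¬ ((openGraph ω).Reachable c a ∨ (openGraph ω).Reachable c a') ∧ ((A.filter fun z => ω ∈ openConn c z).card ≤ j))) ∧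
    (ω ∈ (fun ω : BondConfig (Fin n) => insert s(u, a) (insert s(u, a') ω)) ⁻¹' {ω : BondConfig (Fin n) | (A.filter fun z => ω ∈ openConn a z).card ≤ j} ↔ (((A.filter fun z => ω ∈ openConn a z) ∪ (A.filter fun z => ω ∈ openConn a' z)).card ≤ j)) ∧
    (ω ∈ (fun ω : BondConfig (Fin n) => insert s(u, a) (insert s(u, a') ω)) ⁻¹' {ω : BondConfig (Fin n) | (A.filter fun z => ω ∈ openConn b z).card ≤ j} ↔ (¬ ((openGraph ω).Reachable b a ∨ (openGraph ω).Reachable b a') ∧ ((A.filter fun z => ω ∈ openConn b z).card ≤ j))) ∧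
    (ω ∈ (fun ω : BondConfig (Fin n) => insert s(u, a) (insert s(u, a') ω)) ⁻¹' {ω : BondConfig (Fin n) | 1 ≤ (A.filter fun z => ω ∈ openConn u z).card ∧ (A.filter fun z => ω ∈ openConn u z).card ≤ j} ↔ (((A.filter fun z => ω ∈ openConn a z) ∪ (A.filter fun z => ω ∈ openConn a' z)).card ≤ j)) := by
  have hua : u ≠ a := fun h => hu (h ▸ ha)
  have hua' : u ≠ a' := fun h => hu (h ▸ ha')
  have hub : u ≠ b := fun h => hu (h ▸ hb)
  have hub' : u ≠ b' := fun h => hu (h ▸ hb')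
  have huc : u ≠ c := fun h => hu (h ▸ hc)
  have hva : v ≠ a := fun h => hv (h ▸ ha)
  have hva' : v ≠ a' := fun h => hv (h ▸ ha')
  have hvb : v ≠ b := fun h => hv (h ▸ hb)
  have hvb' : v ≠ b' := fun h => hv (h ▸ hb')
  have hvc : v ≠ c := fun h => hv (h ▸ hc)
  set ω₂ : BondConfig (Fin n) := insert s(v, b) (insert s(v, b') ω) with hω₂
  have hisoU₂ : ∀ y : Fin n, y ≠ u → s(u, y) ∉ ω₂ := isolated_insert_hub ω huv hub hub' hisoU
  have r2 : ∀ {x z : Fin n}, x ≠ v → z ≠ v → ((openGraph ω₂).Reachable x z ↔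
      ((openGraph ω).Reachable x z ∨ (((openGraph ω).Reachable x b ∨ (openGraph ω).Reachable x b') ∧
        ((openGraph ω).Reachable b z ∨ (openGraph ω).Reachable b' z)))) :=
    fun hx hz => reachable_hub_iff ω hvb hvb' hisoV hx hz
  have hCA₂ : ¬ ((openGraph ω).Reachable c b ∨ (openGraph ω).Reachable c b') → (((openGraph ω₂).Reachable c a ∨ (openGraph ω₂).Reachable c a') ↔ ((openGraph ω).Reachable c a ∨ (openGraph ω).Reachable c a')) := by
    intro hcb0
    rw [r2 hvc.symm hva.symm, r2 hvc.symm hva'.symm]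
    constructor
    · rintro (h | h)
      · rcases h with h | ⟨h, -⟩
        · exact Or.inl h
        · exact absurd h hcb0
      · rcases h with h | ⟨h, -⟩
        · exact Or.inr h
        · exact absurd h hcb0
    · rintro (h | h)
      · exact Or.inl (Or.inl h)
      · exact Or.inr (Or.inl h)
  have hcu2 : ¬ (openGraph ω₂).Reachable c u := by
    rw [r2 hvc.symm huv]
    rintro (h | ⟨-, h⟩)
    · exact not_reachable_to_isolated ω huc.symm hisoU h
    · rcases h with h | h
      · exact not_reachable_to_isolated ω hub.symm hisoU h
      · exact not_reachable_to_isolated ω hub'.symm hisoU h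
  have hcv2 : (openGraph ω₂).Reachable c v ↔ ((openGraph ω).Reachable c b ∨ (openGraph ω).Reachable c b') := reachable_hub_center_iff ω hvb hvb' hisoV hvc.symm
  have e0c : ω ∈ {ω : BondConfig (Fin n) | (A.filter fun z => ω ∈ openConn c z).card ≤ j} ↔ ((A.filter fun z => ω ∈ openConn c z).card ≤ j) := Iff.rfl
  have e0a : ω ∈ {ω : BondConfig (Fin n) | (A.filter fun z => ω ∈ openConn a z).card ≤ j} ↔ ((A.filter fun z => ω ∈ openConn a z).card ≤ j) := Iff.rfl
  have e0b : ω ∈ {ω : BondConfig (Fin n) | (A.filter fun z => ω ∈ openConn b z).card ≤ j} ↔ ((A.filter fun z => ω ∈ openConn b z).card ≤ j) := Iff.rfl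
  have e0L : ω ∈ {ω : BondConfig (Fin n) | 1 ≤ (A.filter fun z => ω ∈ openConn u z).card ∧ (A.filter fun z => ω ∈ openConn u z).card ≤ j} ↔ False := by
    constructor
    · intro h
      obtain ⟨h1, -⟩ := h
      rw [filter_isolated_eq_empty A ω hu hisoU, Finset.card_empty] at h1
      exact Nat.not_succ_le_zero 0 h1
    · exact False.elim
  have eUc : ω ∈ (fun ω : BondConfig (Fin n) => insert s(u, a) (insert s(u, a') ω)) ⁻¹' {ω : BondConfig (Fin n) | (A.filter fun z => ω ∈ openConn c z).card ≤ j} ↔ (¬ ((openGraph ω).Reachable c a ∨ (openGraph ω).Reachable c a') ∧ ((A.filter fun z => ω ∈ openConn c z).card ≤ j)) :=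
    small_hub_iff A ω j hj hu ha ha' hc haa' hca hca' hisoU
  have eUa : ω ∈ (fun ω : BondConfig (Fin n) => insert s(u, a) (insert s(u, a') ω)) ⁻¹' {ω : BondConfig (Fin n) | (A.filter fun z => ω ∈ openConn a z).card ≤ j} ↔ (((A.filter fun z => ω ∈ openConn a z) ∪ (A.filter fun z => ω ∈ openConn a' z)).card ≤ j) := small_hub_self_iff A ω j hu ha hua' hisoU
  have eUb : ω ∈ (fun ω : BondConfig (Fin n) => insert s(u, a) (insert s(u, a') ω)) ⁻¹' {ω : BondConfig (Fin n) | (A.filter fun z => ω ∈ openConn b z).card ≤ j} ↔ (¬ ((openGraph ω).Reachable b a ∨ (openGraph ω).Reachable b a') ∧ ((A.filter fun z => ω ∈ openConn b z).card ≤ j)) :=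
    small_hub_iff A ω j hj hu ha ha' hb haa' hab.symm ha'b.symm hisoU
  have eUL : ω ∈ (fun ω : BondConfig (Fin n) => insert s(u, a) (insert s(u, a') ω)) ⁻¹' {ω : BondConfig (Fin n) | 1 ≤ (A.filter fun z => ω ∈ openConn u z).card ∧ (A.filter fun z => ω ∈ openConn u z).card ≤ j} ↔ (((A.filter fun z => ω ∈ openConn a z) ∪ (A.filter fun z => ω ∈ openConn a' z)).card ≤ j) := small_hub_center_iff A ω j hu ha hua hua' hisoU
  exact ⟨e0c, e0a, e0b, e0L, eUc, eUa, eUb, eUL⟩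

/-- Level-2 membership translations, world `V` (glue at `v`). [this file] -/
theorem iffs_v (A : Finset (Fin n)) (ω : BondConfig (Fin n))
    (u v a a' b b' c : Fin n) (j : ℕ) (hj : j ≤ 2) (hu : u ∉ A) (hv : v ∉ A) (huv : u ≠ v)
    (ha : a ∈ A) (ha' : a' ∈ A) (hb : b ∈ A) (hb' : b' ∈ A) (hc : c ∈ A)
    (hbb' : b ≠ b') (hab : a ≠ b) (hab' : a ≠ b')
    (hcb : c ≠ b) (hcb' : c ≠ b')
    (hisoU : ∀ y : Fin n, y ≠ u → s(u, y) ∉ ω) (hisoV : ∀ y : Fin n, y ≠ v → s(v, y) ∉ ω) :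
    (ω ∈ (fun ω : BondConfig (Fin n) => insert s(v, b) (insert s(v, b') ω)) ⁻¹' {ω : BondConfig (Fin n) | (A.filter fun z => ω ∈ openConn c z).card ≤ j} ↔ (¬ ((openGraph ω).Reachable c b ∨ (openGraph ω).Reachable c b') ∧ ((A.filter fun z => ω ∈ openConn c z).card ≤ j))) ∧
    (ω ∈ (fun ω : BondConfig (Fin n) => insert s(v, b) (insert s(v, b') ω)) ⁻¹' {ω : BondConfig (Fin n) | (A.filter fun z => ω ∈ openConn a z).card ≤ j} ↔ (¬ ((openGraph ω).Reachable a b ∨ (openGraph ω).Reachable a b') ∧ ((A.filter fun z => ω ∈ openConn a z).card ≤ j))) ∧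
    (ω ∈ (fun ω : BondConfig (Fin n) => insert s(v, b) (insert s(v, b') ω)) ⁻¹' {ω : BondConfig (Fin n) | (A.filter fun z => ω ∈ openConn b z).card ≤ j} ↔ (((A.filter fun z => ω ∈ openConn b z) ∪ (A.filter fun z => ω ∈ openConn b' z)).card ≤ j)) ∧
    (ω ∈ (fun ω : BondConfig (Fin n) => insert s(v, b) (insert s(v, b') ω)) ⁻¹' {ω : BondConfig (Fin n) | ω ∉ openConn c u ∧ ω ∉ openConn c v ∧ (A.filter fun z => ω ∈ openConn c z).card ≤ j} ↔ (¬ ((openGraph ω).Reachable c b ∨ (openGraph ω).Reachable c b') ∧ ((A.filter fun z => ω ∈ openConn c z).card ≤ j))) ∧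
    (ω ∈ (fun ω : BondConfig (Fin n) => insert s(v, b) (insert s(v, b') ω)) ⁻¹' {ω : BondConfig (Fin n) | ω ∉ openConn c u ∧ ω ∉ openConn c v ∧ 1 ≤ (A.filter fun z => ω ∈ openConn u z ∨ ω ∈ openConn v z).card ∧ (A.filter fun z => ω ∈ openConn u z ∨ ω ∈ openConn v z).card ≤ j} ↔ (¬ ((openGraph ω).Reachable c b ∨ (openGraph ω).Reachable c b') ∧ (((A.filter fun z => ω ∈ openConn b z) ∪ (A.filter fun z => ω ∈ openConn b' z)).card ≤ j))) := by
  have hua : u ≠ a := fun h => hu (h ▸ ha)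
  have hua' : u ≠ a' := fun h => hu (h ▸ ha')
  have hub : u ≠ b := fun h => hu (h ▸ hb)
  have hub' : u ≠ b' := fun h => hu (h ▸ hb')
  have huc : u ≠ c := fun h => hu (h ▸ hc)
  have hva : v ≠ a := fun h => hv (h ▸ ha)
  have hva' : v ≠ a' := fun h => hv (h ▸ ha')
  have hvb : v ≠ b := fun h => hv (h ▸ hb)
  have hvb' : v ≠ b' := fun h => hv (h ▸ hb')
  have hvc : v ≠ c := fun h => hv (h ▸ hc)
  set ω₂ : BondConfig (Fin n) := insert s(v, b) (insert s(v, b') ω) with hω₂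
  have hisoU₂ : ∀ y : Fin n, y ≠ u → s(u, y) ∉ ω₂ := isolated_insert_hub ω huv hub hub' hisoU
  have r2 : ∀ {x z : Fin n}, x ≠ v → z ≠ v → ((openGraph ω₂).Reachable x z ↔
      ((openGraph ω).Reachable x z ∨ (((openGraph ω).Reachable x b ∨ (openGraph ω).Reachable x b') ∧
        ((openGraph ω).Reachable b z ∨ (openGraph ω).Reachable b' z)))) :=
    fun hx hz => reachable_hub_iff ω hvb hvb' hisoV hx hz
  have hCA₂ : ¬ ((openGraph ω).Reachable c b ∨ (openGraph ω).Reachable c b') → (((openGraph ω₂).Reachable c a ∨ (openGraph ω₂).Reachable c a') ↔ ((openGraph ω).Reachable c a ∨ (openGraph ω).Reachable c a')) := by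
    intro hcb0
    rw [r2 hvc.symm hva.symm, r2 hvc.symm hva'.symm]
    constructor
    · rintro (h | h)
      · rcases h with h | ⟨h, -⟩
        · exact Or.inl h
        · exact absurd h hcb0
      · rcases h with h | ⟨h, -⟩
        · exact Or.inr h
        · exact absurd h hcb0
    · rintro (h | h)
      · exact Or.inl (Or.inl h)
      · exact Or.inr (Or.inl h)
  have hcu2 : ¬ (openGraph ω₂).Reachable c u := by
    rw [r2 hvc.symm huv]
    rintro (h | ⟨-, h⟩)
    · exact not_reachable_to_isolated ω huc.symm hisoU h
    · rcases h with h | h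
      · exact not_reachable_to_isolated ω hub.symm hisoU h
      · exact not_reachable_to_isolated ω hub'.symm hisoU h
  have hcv2 : (openGraph ω₂).Reachable c v ↔ ((openGraph ω).Reachable c b ∨ (openGraph ω).Reachable c b') := reachable_hub_center_iff ω hvb hvb' hisoV hvc.symm
  have hFV : (A.filter fun z => ω₂ ∈ openConn u z ∨ ω₂ ∈ openConn v z) =
      (A.filter fun z => ω ∈ openConn b z) ∪ (A.filter fun z => ω ∈ openConn b' z) := by
    rw [← filter_hub_center A ω hv hvb hvb' hisoV]
    refine Finset.filter_congr fun z hz => ?_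
    have hzu : z ≠ u := fun h => hu (h ▸ hz)
    constructor
    · rintro (h | h)
      · exact absurd (h : (openGraph ω₂).Reachable u z).symm (not_reachable_to_isolated ω₂ hzu hisoU₂)
      · exact h
    · exact fun h => Or.inr h
  have eVc : ω ∈ (fun ω : BondConfig (Fin n) => insert s(v, b) (insert s(v, b') ω)) ⁻¹' {ω : BondConfig (Fin n) | (A.filter fun z => ω ∈ openConn c z).card ≤ j} ↔ (¬ ((openGraph ω).Reachable c b ∨ (openGraph ω).Reachable c b') ∧ ((A.filter fun z => ω ∈ openConn c z).card ≤ j)) :=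
    small_hub_iff A ω j hj hv hb hb' hc hbb' hcb hcb' hisoV
  have eVa : ω ∈ (fun ω : BondConfig (Fin n) => insert s(v, b) (insert s(v, b') ω)) ⁻¹' {ω : BondConfig (Fin n) | (A.filter fun z => ω ∈ openConn a z).card ≤ j} ↔ (¬ ((openGraph ω).Reachable a b ∨ (openGraph ω).Reachable a b') ∧ ((A.filter fun z => ω ∈ openConn a z).card ≤ j)) :=
    small_hub_iff A ω j hj hv hb hb' ha hbb' hab hab' hisoV
  have eVb : ω ∈ (fun ω : BondConfig (Fin n) => insert s(v, b) (insert s(v, b') ω)) ⁻¹' {ω : BondConfig (Fin n) | (A.filter fun z => ω ∈ openConn b z).card ≤ j} ↔ (((A.filter fun z => ω ∈ openConn b z) ∪ (A.filter fun z => ω ∈ openConn b' z)).card ≤ j) := small_hub_self_iff A ω j hv hb hvb' hisoV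
  have eVρ : ω ∈ (fun ω : BondConfig (Fin n) => insert s(v, b) (insert s(v, b') ω)) ⁻¹' {ω : BondConfig (Fin n) | ω ∉ openConn c u ∧ ω ∉ openConn c v ∧ (A.filter fun z => ω ∈ openConn c z).card ≤ j} ↔ (¬ ((openGraph ω).Reachable c b ∨ (openGraph ω).Reachable c b') ∧ ((A.filter fun z => ω ∈ openConn c z).card ≤ j)) := by
    show (ω₂ ∉ openConn c u ∧ ω₂ ∉ openConn c v ∧ (A.filter fun z => ω₂ ∈ openConn c z).card ≤ j) ↔ _
    have hc3 : (A.filter fun z => ω₂ ∈ openConn c z).card ≤ j ↔ (¬ ((openGraph ω).Reachable c b ∨ (openGraph ω).Reachable c b') ∧ ((A.filter fun z => ω ∈ openConn c z).card ≤ j)) := eVc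
    rw [hc3]
    constructor
    · rintro ⟨-, -, h⟩; exact h
    · rintro ⟨h1, h2⟩; exact ⟨hcu2, fun h => h1 (hcv2.1 h), h1, h2⟩
  have eVℓ : ω ∈ (fun ω : BondConfig (Fin n) => insert s(v, b) (insert s(v, b') ω)) ⁻¹' {ω : BondConfig (Fin n) | ω ∉ openConn c u ∧ ω ∉ openConn c v ∧ 1 ≤ (A.filter fun z => ω ∈ openConn u z ∨ ω ∈ openConn v z).card ∧ (A.filter fun z => ω ∈ openConn u z ∨ ω ∈ openConn v z).card ≤ j} ↔ (¬ ((openGraph ω).Reachable c b ∨ (openGraph ω).Reachable c b') ∧ (((A.filter fun z => ω ∈ openConn b z) ∪ (A.filter fun z => ω ∈ openConn b' z)).card ≤ j)) := by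
    show (ω₂ ∉ openConn c u ∧ ω₂ ∉ openConn c v ∧ 1 ≤ (A.filter fun z => ω₂ ∈ openConn u z ∨ ω₂ ∈ openConn v z).card ∧
      (A.filter fun z => ω₂ ∈ openConn u z ∨ ω₂ ∈ openConn v z).card ≤ j) ↔ _
    rw [hFV]
    constructor
    · rintro ⟨-, h2, -, h4⟩; exact ⟨fun h => h2 (hcv2.2 h), h4⟩
    · rintro ⟨h1, h2⟩
      refine ⟨hcu2, fun h => h1 (hcv2.1 h), Finset.card_pos.2 ⟨b, Finset.mem_union.2 (Or.inl (Finset.mem_filter.2 ⟨hb, ?_⟩))⟩, h2⟩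
      exact (SimpleGraph.Reachable.refl _ : (openGraph ω).Reachable b b)
  exact ⟨eVc, eVa, eVb, eVρ, eVℓ⟩

/-- Level-2 membership translations, world `W` (glue at both hubs). [this file] -/
theorem iffs_w (A : Finset (Fin n)) (ω : BondConfig (Fin n))
    (u v a a' b b' c : Fin n) (j : ℕ) (hj : j ≤ 2) (hu : u ∉ A) (hv : v ∉ A) (huv : u ≠ v)
    (ha : a ∈ A) (ha' : a' ∈ A) (hb : b ∈ A) (hb' : b' ∈ A) (hc : c ∈ A)
    (haa' : a ≠ a') (hbb' : b ≠ b') (hab : a ≠ b) (hab' : a ≠ b') (ha'b : a' ≠ b) (ha'b' : a' ≠ b')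
    (hca : c ≠ a) (hca' : c ≠ a') (hcb : c ≠ b) (hcb' : c ≠ b')
    (hisoU : ∀ y : Fin n, y ≠ u → s(u, y) ∉ ω) (hisoV : ∀ y : Fin n, y ≠ v → s(v, y) ∉ ω) :
    (ω ∈ (fun ω : BondConfig (Fin n) => insert s(u, a) (insert s(u, a') (insert s(v, b) (insert s(v, b') ω)))) ⁻¹' {ω : BondConfig (Fin n) | (A.filter fun z => ω ∈ openConn c z).card ≤ j} ↔ (¬ ((openGraph ω).Reachable c a ∨ (openGraph ω).Reachable c a') ∧ ¬ ((openGraph ω).Reachable c b ∨ (openGraph ω).Reachable c b') ∧ ((A.filter fun z => ω ∈ openConn c z).card ≤ j))) ∧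
    (ω ∈ (fun ω : BondConfig (Fin n) => insert s(u, a) (insert s(u, a') (insert s(v, b) (insert s(v, b') ω)))) ⁻¹' {ω : BondConfig (Fin n) | (A.filter fun z => ω ∈ openConn a z).card ≤ j} ↔ (((A.filter fun z => ω ∈ openConn a z) ∪ (A.filter fun z => ω ∈ openConn a' z)).card ≤ j)) ∧
    (ω ∈ (fun ω : BondConfig (Fin n) => insert s(u, a) (insert s(u, a') (insert s(v, b) (insert s(v, b') ω)))) ⁻¹' {ω : BondConfig (Fin n) | (A.filter fun z => ω ∈ openConn b z).card ≤ j} ↔ (((A.filter fun z => ω ∈ openConn b z) ∪ (A.filter fun z => ω ∈ openConn b' z)).card ≤ j)) ∧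
    (ω ∈ (fun ω : BondConfig (Fin n) => insert s(u, a) (insert s(u, a') (insert s(v, b) (insert s(v, b') ω)))) ⁻¹' {ω : BondConfig (Fin n) | ω ∉ openConn c u ∧ ω ∉ openConn c v ∧ (A.filter fun z => ω ∈ openConn c z).card ≤ j} ↔ (¬ ((openGraph ω).Reachable c a ∨ (openGraph ω).Reachable c a') ∧ ¬ ((openGraph ω).Reachable c b ∨ (openGraph ω).Reachable c b') ∧ ((A.filter fun z => ω ∈ openConn c z).card ≤ j))) ∧
    (ω ∈ (fun ω : BondConfig (Fin n) => insert s(u, a) (insert s(u, a') (insert s(v, b) (insert s(v, b') ω)))) ⁻¹' {ω : BondConfig (Fin n) | ω ∉ openConn c u ∧ ω ∉ openConn c v ∧ 1 ≤ (A.filter fun z => ω ∈ openConn u z ∨ ω ∈ openConn v z).card ∧ (A.filter fun z => ω ∈ openConn u z ∨ ω ∈ openConn v z).card ≤ j} ↔ False) := by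
  have hua : u ≠ a := fun h => hu (h ▸ ha)
  have hua' : u ≠ a' := fun h => hu (h ▸ ha')
  have hub : u ≠ b := fun h => hu (h ▸ hb)
  have hub' : u ≠ b' := fun h => hu (h ▸ hb')
  have huc : u ≠ c := fun h => hu (h ▸ hc)
  have hva : v ≠ a := fun h => hv (h ▸ ha)
  have hva' : v ≠ a' := fun h => hv (h ▸ ha')
  have hvb : v ≠ b := fun h => hv (h ▸ hb)
  have hvb' : v ≠ b' := fun h => hv (h ▸ hb')
  have hvc : v ≠ c := fun h => hv (h ▸ hc)
  set ω₂ : BondConfig (Fin n) := insert s(v, b) (insert s(v, b') ω) with hω₂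
  have hisoU₂ : ∀ y : Fin n, y ≠ u → s(u, y) ∉ ω₂ := isolated_insert_hub ω huv hub hub' hisoU
  have r2 : ∀ {x z : Fin n}, x ≠ v → z ≠ v → ((openGraph ω₂).Reachable x z ↔
      ((openGraph ω).Reachable x z ∨ (((openGraph ω).Reachable x b ∨ (openGraph ω).Reachable x b') ∧
        ((openGraph ω).Reachable b z ∨ (openGraph ω).Reachable b' z)))) :=
    fun hx hz => reachable_hub_iff ω hvb hvb' hisoV hx hz
  have hCA₂ : ¬ ((openGraph ω).Reachable c b ∨ (openGraph ω).Reachable c b') → (((openGraph ω₂).Reachable c a ∨ (openGraph ω₂).Reachable c a') ↔ ((openGraph ω).Reachable c a ∨ (openGraph ω).Reachable c a')) := by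
    intro hcb0
    rw [r2 hvc.symm hva.symm, r2 hvc.symm hva'.symm]
    constructor
    · rintro (h | h)
      · rcases h with h | ⟨h, -⟩
        · exact Or.inl h
        · exact absurd h hcb0
      · rcases h with h | ⟨h, -⟩
        · exact Or.inr h
        · exact absurd h hcb0
    · rintro (h | h)
      · exact Or.inl (Or.inl h)
      · exact Or.inr (Or.inl h)
  have hcu2 : ¬ (openGraph ω₂).Reachable c u := by
    rw [r2 hvc.symm huv]
    rintro (h | ⟨-, h⟩)
    · exact not_reachable_to_isolated ω huc.symm hisoU h
    · rcases h with h | h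
      · exact not_reachable_to_isolated ω hub.symm hisoU h
      · exact not_reachable_to_isolated ω hub'.symm hisoU h
  have hcv2 : (openGraph ω₂).Reachable c v ↔ ((openGraph ω).Reachable c b ∨ (openGraph ω).Reachable c b') := reachable_hub_center_iff ω hvb hvb' hisoV hvc.symm
  have hFV : (A.filter fun z => ω₂ ∈ openConn u z ∨ ω₂ ∈ openConn v z) =
      (A.filter fun z => ω ∈ openConn b z) ∪ (A.filter fun z => ω ∈ openConn b' z) := by
    rw [← filter_hub_center A ω hv hvb hvb' hisoV]
    refine Finset.filter_congr fun z hz => ?_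
    have hzu : z ≠ u := fun h => hu (h ▸ hz)
    constructor
    · rintro (h | h)
      · exact absurd (h : (openGraph ω₂).Reachable u z).symm (not_reachable_to_isolated ω₂ hzu hisoU₂)
      · exact h
    · exact fun h => Or.inr h
  have eVc : ω ∈ (fun ω : BondConfig (Fin n) => insert s(v, b) (insert s(v, b') ω)) ⁻¹' {ω : BondConfig (Fin n) | (A.filter fun z => ω ∈ openConn c z).card ≤ j} ↔ (¬ ((openGraph ω).Reachable c b ∨ (openGraph ω).Reachable c b') ∧ ((A.filter fun z => ω ∈ openConn c z).card ≤ j)) :=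
    small_hub_iff A ω j hj hv hb hb' hc hbb' hcb hcb' hisoV
  have eVb : ω ∈ (fun ω : BondConfig (Fin n) => insert s(v, b) (insert s(v, b') ω)) ⁻¹' {ω : BondConfig (Fin n) | (A.filter fun z => ω ∈ openConn b z).card ≤ j} ↔ (((A.filter fun z => ω ∈ openConn b z) ∪ (A.filter fun z => ω ∈ openConn b' z)).card ≤ j) := small_hub_self_iff A ω j hv hb hvb' hisoV
  have eWc : ω ∈ (fun ω : BondConfig (Fin n) => insert s(u, a) (insert s(u, a') (insert s(v, b) (insert s(v, b') ω)))) ⁻¹' {ω : BondConfig (Fin n) | (A.filter fun z => ω ∈ openConn c z).card ≤ j} ↔ (¬ ((openGraph ω).Reachable c a ∨ (openGraph ω).Reachable c a') ∧ ¬ ((openGraph ω).Reachable c b ∨ (openGraph ω).Reachable c b') ∧ ((A.filter fun z => ω ∈ openConn c z).card ≤ j)) := by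
    show (A.filter fun z => insert s(u, a) (insert s(u, a') ω₂) ∈ openConn c z).card ≤ j ↔ _
    rw [small_hub_iff A ω₂ j hj hu ha ha' hc haa' hca hca' hisoU₂]
    have hc3 : (A.filter fun z => ω₂ ∈ openConn c z).card ≤ j ↔ (¬ ((openGraph ω).Reachable c b ∨ (openGraph ω).Reachable c b') ∧ ((A.filter fun z => ω ∈ openConn c z).card ≤ j)) := eVc
    rw [hc3]
    constructor
    · rintro ⟨h1, h2, h3⟩; exact ⟨fun h => h1 ((hCA₂ h2).2 h), h2, h3⟩
    · rintro ⟨h1, h2, h3⟩; exact ⟨fun h => h1 ((hCA₂ h2).1 h), h2, h3⟩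
  have eWa : ω ∈ (fun ω : BondConfig (Fin n) => insert s(u, a) (insert s(u, a') (insert s(v, b) (insert s(v, b') ω)))) ⁻¹' {ω : BondConfig (Fin n) | (A.filter fun z => ω ∈ openConn a z).card ≤ j} ↔ (((A.filter fun z => ω ∈ openConn a z) ∪ (A.filter fun z => ω ∈ openConn a' z)).card ≤ j) := by
    show (A.filter fun z => insert s(u, a) (insert s(u, a') ω₂) ∈ openConn a z).card ≤ j ↔ _
    rw [small_hub_self_iff A ω₂ j hu ha hua' hisoU₂]
    constructor
    · intro h
      refine le_trans (Finset.card_le_card (Finset.union_subset_union ?_ ?_)) h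
      · intro z hz; rw [Finset.mem_filter] at hz ⊢
        exact ⟨hz.1, reachable_insert_of_reachable _ _ (reachable_insert_of_reachable _ _ hz.2)⟩
      · intro z hz; rw [Finset.mem_filter] at hz ⊢
        exact ⟨hz.1, reachable_insert_of_reachable _ _ (reachable_insert_of_reachable _ _ hz.2)⟩
    · intro h
      have hna := not_reachable_of_small_pair A ω j hj ha ha' hb haa' hab.symm ha'b.symm h
      have hna' := not_reachable_of_small_pair A ω j hj ha ha' hb' haa' hab'.symm ha'b'.symm h
      have hfa : (A.filter fun z => ω₂ ∈ openConn a z) = (A.filter fun z => ω ∈ openConn a z) :=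
        filter_hub_eq_of_not A ω hv hvb hvb' hva.symm hisoV (fun h' => hna.1 h'.symm) (fun h' => hna'.1 h'.symm)
      have hfa' : (A.filter fun z => ω₂ ∈ openConn a' z) = (A.filter fun z => ω ∈ openConn a' z) :=
        filter_hub_eq_of_not A ω hv hvb hvb' hva'.symm hisoV (fun h' => hna.2 h'.symm) (fun h' => hna'.2 h'.symm)
      rw [hfa, hfa']; exact h
  have eWb : ω ∈ (fun ω : BondConfig (Fin n) => insert s(u, a) (insert s(u, a') (insert s(v, b) (insert s(v, b') ω)))) ⁻¹' {ω : BondConfig (Fin n) | (A.filter fun z => ω ∈ openConn b z).card ≤ j} ↔ (((A.filter fun z => ω ∈ openConn b z) ∪ (A.filter fun z => ω ∈ openConn b' z)).card ≤ j) := by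
    show (A.filter fun z => insert s(u, a) (insert s(u, a') ω₂) ∈ openConn b z).card ≤ j ↔ _
    rw [small_hub_iff A ω₂ j hj hu ha ha' hb haa' hab.symm ha'b.symm hisoU₂]
    have hb3 : (A.filter fun z => ω₂ ∈ openConn b z).card ≤ j ↔ (((A.filter fun z => ω ∈ openConn b z) ∪ (A.filter fun z => ω ∈ openConn b' z)).card ≤ j) := eVb
    rw [hb3]
    constructor
    · rintro ⟨-, h⟩; exact h
    · intro h
      refine ⟨?_, h⟩
      -- if b were attached to a (or a') in ω₂, then a (or a') would lie in π(b) ∪ π(b'), a set of size ≤ 2 = {b,b'}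
      have hna : ¬ (openGraph ω).Reachable a b ∧ ¬ (openGraph ω).Reachable a b' :=
        not_reachable_of_small_pair A ω j hj hb hb' ha hbb' hab hab' h
      have hna' : ¬ (openGraph ω).Reachable a' b ∧ ¬ (openGraph ω).Reachable a' b' :=
        not_reachable_of_small_pair A ω j hj hb hb' ha' hbb' ha'b ha'b' h
      rintro (hh | hh)
      · rcases (r2 hvb.symm hva.symm).1 hh with hh | ⟨-, hh | hh⟩
        · exact hna.1 hh.symm
        · exact hna.1 hh.symm
        · exact hna.2 hh.symm
      · rcases (r2 hvb.symm hva'.symm).1 hh with hh | ⟨-, hh | hh⟩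
        · exact hna'.1 hh.symm
        · exact hna'.1 hh.symm
        · exact hna'.2 hh.symm
  have eWρ : ω ∈ (fun ω : BondConfig (Fin n) => insert s(u, a) (insert s(u, a') (insert s(v, b) (insert s(v, b') ω)))) ⁻¹' {ω : BondConfig (Fin n) | ω ∉ openConn c u ∧ ω ∉ openConn c v ∧ (A.filter fun z => ω ∈ openConn c z).card ≤ j} ↔ (¬ ((openGraph ω).Reachable c a ∨ (openGraph ω).Reachable c a') ∧ ¬ ((openGraph ω).Reachable c b ∨ (openGraph ω).Reachable c b') ∧ ((A.filter fun z => ω ∈ openConn c z).card ≤ j)) := by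
    show (insert s(u, a) (insert s(u, a') ω₂) ∉ openConn c u ∧ insert s(u, a) (insert s(u, a') ω₂) ∉ openConn c v ∧
      (A.filter fun z => insert s(u, a) (insert s(u, a') ω₂) ∈ openConn c z).card ≤ j) ↔ _
    have hc3 : (A.filter fun z => insert s(u, a) (insert s(u, a') ω₂) ∈ openConn c z).card ≤ j ↔ (¬ ((openGraph ω).Reachable c a ∨ (openGraph ω).Reachable c a') ∧ ¬ ((openGraph ω).Reachable c b ∨ (openGraph ω).Reachable c b') ∧ ((A.filter fun z => ω ∈ openConn c z).card ≤ j)) := eWc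
    rw [hc3]
    have hcu3 : (openGraph (insert s(u, a) (insert s(u, a') ω₂))).Reachable c u ↔
        ((openGraph ω₂).Reachable c a ∨ (openGraph ω₂).Reachable c a') := reachable_hub_center_iff ω₂ hua hua' hisoU₂ huc.symm
    have hcv3 : (openGraph (insert s(u, a) (insert s(u, a') ω₂))).Reachable c v ↔
        ((openGraph ω₂).Reachable c v ∨ (((openGraph ω₂).Reachable c a ∨ (openGraph ω₂).Reachable c a') ∧
          ((openGraph ω₂).Reachable a v ∨ (openGraph ω₂).Reachable a' v))) := reachable_hub_iff ω₂ hua hua' hisoU₂ huc.symm huv.symm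
    constructor
    · rintro ⟨-, -, h⟩; exact h
    · rintro ⟨h1, h2, h3⟩
      have hca2 : ¬ ((openGraph ω₂).Reachable c a ∨ (openGraph ω₂).Reachable c a') := fun h => h1 ((hCA₂ h2).1 h)
      refine ⟨fun h => hca2 (hcu3.1 h), fun h => ?_, h1, h2, h3⟩
      rcases hcv3.1 h with h | ⟨h, -⟩
      · exact h2 (hcv2.1 h)
      · exact hca2 h
  have eWℓ : ω ∈ (fun ω : BondConfig (Fin n) => insert s(u, a) (insert s(u, a') (insert s(v, b) (insert s(v, b') ω)))) ⁻¹' {ω : BondConfig (Fin n) | ω ∉ openConn c u ∧ ω ∉ openConn c v ∧ 1 ≤ (A.filter fun z => ω ∈ openConn u z ∨ ω ∈ openConn v z).card ∧ (A.filter fun z => ω ∈ openConn u z ∨ ω ∈ openConn v z).card ≤ j} ↔ False := by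
    constructor
    · intro hmem
      have h4 : (A.filter fun z => insert s(u, a) (insert s(u, a') ω₂) ∈ openConn u z ∨
          insert s(u, a) (insert s(u, a') ω₂) ∈ openConn v z).card ≤ j := hmem.2.2.2
      -- a, a', b lie in π(u) ∪ π(v) of the doubly glued configuration
      have hm : ∀ z : Fin n, z ∈ A → ((openGraph (insert s(u, a) (insert s(u, a') ω₂))).Reachable u z ∨
          (openGraph (insert s(u, a) (insert s(u, a') ω₂))).Reachable v z) →
          z ∈ (A.filter fun z => insert s(u, a) (insert s(u, a') ω₂) ∈ openConn u z ∨ insert s(u, a) (insert s(u, a') ω₂) ∈ openConn v z) :=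
        fun z hz h => Finset.mem_filter.2 ⟨hz, h⟩
      have hza : a ∈ (A.filter fun z => insert s(u, a) (insert s(u, a') ω₂) ∈ openConn u z ∨
          insert s(u, a) (insert s(u, a') ω₂) ∈ openConn v z) := hm a ha (Or.inl ((reachable_hub_center_iff ω₂ hua hua' hisoU₂ hua.symm).2 (Or.inl (SimpleGraph.Reachable.refl _))).symm)
      have hza' : a' ∈ (A.filter fun z => insert s(u, a) (insert s(u, a') ω₂) ∈ openConn u z ∨
          insert s(u, a) (insert s(u, a') ω₂) ∈ openConn v z) := hm a' ha' (Or.inl ((reachable_hub_center_iff ω₂ hua hua' hisoU₂ hua'.symm).2 (Or.inr (SimpleGraph.Reachable.refl _))).symm)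
      have hzb : b ∈ (A.filter fun z => insert s(u, a) (insert s(u, a') ω₂) ∈ openConn u z ∨
          insert s(u, a) (insert s(u, a') ω₂) ∈ openConn v z) := hm b hb (Or.inr (reachable_insert_of_reachable _ _ (reachable_insert_of_reachable _ _
        ((reachable_hub_center_iff ω hvb hvb' hisoV hvb.symm).2 (Or.inl (SimpleGraph.Reachable.refl _))).symm)))
      have h3 := three_le_card_of_mem hza hza' hzb haa' hab ha'b
      omega
    · exact False.elim
  exact ⟨eWc, eWa, eWb, eWρ, eWℓ⟩

end TwoPortPeeling

end Summit.CriticalPhenomena.PercolationContinuityZ3.Theorems
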